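/-
Origin: expansion seat `planner-pub-hodgecm-mc-sanity-1-g13-0`, handover #SAN29 2026-08-20T16:43Z md5 d07694a75b0b (SAN-29; NEW additive KERNEL census leaf, 131 l., 4 theorems ∕ 0 defs in ns HodgeCM.Model.Sanity — a good sextic context of `thetaModelOf … (hb K ι₁) …` OVER THE SEXTIC ITSELF at a canonical ι₁: `exists_goodSexticO_self_at` (any `j : K →+* K`, `ι₁ ∘ j = φ 0`: anisotropic `V : HermSpace3 K ι₁` + seesaw datum `D` over `K` with `GoodCtx ι₁ ⟨K, t, φ 0, D⟩ ∧ SignsForced K K j ι₁ t D ∧ finrank = 6`), `exists_goodSexticO_self_id` (`j := id`, `ι₁ := φ 0`), `exists_goodSexticO_self_canonical` (∃ sextic `K` of PerL's class — normal closure `E`, `[E:ℚ] ∈ {24,48}` recorded — with an anisotropic good context over itself at a CANONICAL ι₁), `exists_embedding_mk_comp_self` (Mathlib CM re-basing); imports Model.GoodSexticWitnessO only (outside E's cone, no rowdep); drop-alone; rc 0 ∕ 0 warn ∕ 0 proof-hole ∕ axioms trio 4 ∕ 4; NAME LIST: HodgeCM.Model.Sanity.exists_embedding_mk_comp_self ·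 HodgeCM.Model.Sanity.exists_goodSexticO_self_at · HodgeCM.Model.Sanity.exists_goodSexticO_self_id · HodgeCM.Model.Sanity.exists_goodSexticO_self_canonical) (`HOME/mc/pub-hodgecm-mc-sanity-1-g13/next13/HodgeCM/Model/Sanity/GoodSexticSelf.lean`, md5 d07694a75b0b, 131 lines);
landed by the second packager p2 gen 10 (p2-g10) in gate run 56 as `HodgeCM/Model/Sanity/GoodSexticSelf.lean` (verbatim).
-/
/-
HodgeCM / MODEL-CONSTRUCTION sub-cell (pub-hodgecm), SANITY lane (unit `pub-hodgecm-mc-sanity-1-g13`, node SAN-29).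
NEW additive KERNEL leaf `HodgeCM/Model/Sanity/GoodSexticSelf.lean`; imports `HodgeCM.Model.GoodSexticWitnessO` (theta-3 (O2),
RUN 44) only — deliberately NOT the SAN-27/28 chain, so that this leaf stays OUTSIDE the cone of E; nothing imports it; 0 records, 0 `def … : Prop`, 0 hypotheses records, no proof holes; MODEL-N ±0.
-/
import Summits.HodgeConjecture.HodgeCM.Model.GoodSexticWitnessO

/-!
# SAN-29 — a good SEXTIC context of the END STATE's model OVER THE SEXTIC ITSELF (`L := K`, `j := id`)

Census answer to binder-1's satisfiability question (Q) (STATUS 2026-08-20, FLAG «row 9 `hΘ` off PerL's scope»):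
«is `GoodCtx ι₁ c ∧ finrank ℚ c.K = 6` satisfiable with `L = c.K`?» — at PerL's own (non-Galois) witness sextic.

E's ∀(L, ι₁, V, c)-binders (rows 5–19 of `Model.perL_picardCM_r21AEOGI`) are guarded by
`(thetaModelOf … (hb L ι₁) …).GoodCtx ι₁ c`, `Module.finrank ℚ c.K = 6` and `(NumberField.InfinitePlace.mk ι₁).embedding = ι₁`.
SAN-28's engine `Sanity.exists_goodSexticO_at` (`Sanity/DegenerateClosureOGEmpty.lean`) produces such a context at ANY prescribed universe point `(L, j, ι₁)` with
`ι₁ ∘ j = φ 0`, using the degree hypothesis `[L:ℚ] ∈ {24, 48}` ONLY for anisotropy (`4 ≤ [L:ℚ]`).  THIS FILE runs the same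
construction with the surface field equal to the type field — `L := K`, `j : K →+* K` (`id`, or `complexConj K` for the
canonical representative), anisotropy from `4 ≤ 6`:

* `exists_goodSexticO_self_at` — for EVERY bit family `hb` and ALL data `(emb, cover, wm, Theta, d12, d34)`: a sextic CM
  field `K` with frame `φ` and PerL types `t`, any `j : K →+* K` and any `ι₁ : K →+* ℂ` with `ι₁ ∘ j = φ 0` carry an
  ANISOTROPIC hermitian space `V : HermSpace3 K ι₁` and a seesaw datum `D` over `K` such that the context
  `⟨K, t, φ 0, D⟩ : SeesawCtx K` (type field `c.K := K` SYNTACTICALLY) is GOOD for `thetaModelOf … (hb K ι₁) …`;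
* `exists_goodSexticO_self_id` — the instance `j := RingHom.id K`, `ι₁ := φ 0`, with the forced-sign clause
  `SignsForced K K (RingHom.id K) (φ 0) t D` exposed;
* `exists_goodSexticO_self_canonical` — hence, for every `hb` and all data, SOME sextic `K` (PerL's hypothesis class
  `perLHypothesesInhabited`: it has a normal closure `E` with `[E:ℚ] ∈ {24, 48}`, recorded in the conclusion) carries, OVER
  ITSELF, an anisotropic good sextic context at a CANONICAL `ι₁` (`(mk ι₁).embedding = ι₁`) — i.e. ALL THREE GUARDS of
  rows 5–19 are met at a universe point `(L, ι₁) = (K, ι₁)` whose surface field is the sextic type field.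

READING (census; nothing about E is asserted or refuted): E's guards do not confine the ∀(L,V,c)-binders to PerL's
normal-closure contexts `L = K̃`; they are also live at `L = K`.  Whether a given PROVE binder is true there is a
question about the binder, not settled here (over the degenerate side datum `S := degS` all of them but `C` hold at every
context, SAN-22/27/28).
-/

set_option autoImplicit false

noncomputable section

namespace HodgeCM
namespace Model
namespace Sanity

open HodgeCM.Universe (SideData ThetaModel)
open Literature.AlgebraicGeometry.HodgeTheory
open Literature.NumberTheory.Automorphic.PicardCM
open Literature.AlgebraicGeometry.Motives (CMType)

/-- For a CM field `K`, the CANONICAL representative `(mk ι).embedding` of the place of `ι : K →+* ℂ` is `ι` re-based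
along an endomorphism of `K` — the identity or complex conjugation (Mathlib: `embedding_mk_eq`, `IsCMField.complexConj`;
the `j := id` instance of SAN-28 `exists_embedding_mk_comp_eq`, restated here to keep this leaf outside E's cone). -/
theorem exists_embedding_mk_comp_self (K : CMField) (ι : K →+* ℂ) :
    ∃ j : K →+* K, (NumberField.InfinitePlace.mk ι).embedding.comp j = ι := by
  rcases NumberField.InfinitePlace.embedding_mk_eq ι with h | h
  · exact ⟨RingHom.id K, by rw [h, RingHom.comp_id]⟩
  · refine ⟨((NumberField.IsCMField.complexConj K :
      K ≃ₐ[↥(NumberField.maximalRealSubfield K)] K) : K →+* K), ?_⟩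
    rw [h]
    ext x
    simp [NumberField.ComplexEmbedding.conjugate_coe_eq]

variable (hHD : exists_isReal_hodgeModel) (hI : hodgePQ_independent_of_hodgeModel)
  (h₁ : BallQuotientUniformised)  (h₃ : CMAbelianVarietyRealised)

/-- **The (O2) construction OVER THE SEXTIC ITSELF, at a prescribed point.**  For ANY bit family `hb` and ANY data: a
sextic CM field `K` with frame `φ` and PerL types `t`, any `j : K →+* K` and any `ι₁ : K →+* ℂ` with `ι₁ ∘ j = φ 0` carry
an anisotropic good sextic context of `thetaModelOf … (hb K ι₁) …` over the surface field `L := K`, with type field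
`c.K := K` (proof = SAN-28 `exists_goodSexticO_at` with `(L, j) := (K, j)`, anisotropy from `4 ≤ 6`). -/
theorem exists_goodSexticO_self_at (hb : ∀ L : CMField, (L →+* ℂ) → Bool) (emb) (cover) (wm) (Theta)
    (d12 d34 : ∀ {L : CMField}, SeesawCtx L → SideData L)
    {K : CMField} (hK : Module.finrank ℚ K = 6)
    (φ : Fin 3 → (K →+* ℂ)) (hφ : IsFrame φ) (t : Fin 4 → CMType K) (ht : IsPerLTypes φ t)
    (j : K →+* K) (ι₁ : K →+* ℂ) (hι₁ : ι₁.comp j = φ 0) :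
    ∃ (V : HermSpace3 K ι₁) (D : StubTree.SeesawDatum K),
      IsAnisotropic K V.Hm ∧
        (thetaModelOf hHD hI h₁ h₃ (hb K ι₁) emb cover wm Theta d12 d34).GoodCtx ι₁ (⟨K, t, φ 0, D⟩ : SeesawCtx K) ∧
        (thetaModelOf hHD hI h₁ h₃ (hb K ι₁) emb cover wm Theta d12 d34).SignsForced K K j ι₁ t D ∧
        Module.finrank ℚ (⟨K, t, φ 0, D⟩ : SeesawCtx K).K = 6 := by
  have hκ := (thetaModelOf hHD hI h₁ h₃ (hb K ι₁) emb cover wm Theta d12 d34).design_kappaConj_of_eq (hb K ι₁) rfl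
  have hs := (thetaModelOf hHD hI h₁ h₃ (hb K ι₁) emb cover wm Theta d12 d34).design_frameSignConj_of_eq rfl
  have hΨ : PairSum t := StubTree.pairSum_of_isPerLTypes K φ hφ hK t ht
  obtain ⟨D, hD⟩ :=
    (thetaModelOf hHD hI h₁ h₃ (hb K ι₁) emb cover wm Theta d12 d34).exists_seesawDatum_constructed hκ hs j ι₁ t hΨ
  obtain ⟨V⟩ := StubTree.landherr_exists K ι₁
  have h4 : 4 ≤ Module.finrank ℚ K := by omega
  exact ⟨V, D, V.isAnisotropic h4,
    ⟨hΨ, StubTree.injective_of_isPerLTypes K φ hφ t ht, fun i => (ht i 0).mpr (by fin_cases i <;> rfl),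
      ⟨j, hι₁, hD⟩⟩, hD, hK⟩

/-- **The instance `j := id`, `ι₁ := φ 0`** (binder-1's (Q) verbatim): over `L := K` the frame embedding `φ 0` itself carries
an anisotropic good sextic context of type field `K`, the lines of its seesaw datum having PerL's forced signs ALONG THE
IDENTITY `RingHom.id K`. -/
theorem exists_goodSexticO_self_id (hb : ∀ L : CMField, (L →+* ℂ) → Bool) (emb) (cover) (wm) (Theta)
    (d12 d34 : ∀ {L : CMField}, SeesawCtx L → SideData L)
    {K : CMField} (hK : Module.finrank ℚ K = 6)
    (φ : Fin 3 → (K →+* ℂ)) (hφ : IsFrame φ) (t : Fin 4 → CMType K) (ht : IsPerLTypes φ t) :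
    ∃ (V : HermSpace3 K (φ 0)) (D : StubTree.SeesawDatum K),
      IsAnisotropic K V.Hm ∧
        (thetaModelOf hHD hI h₁ h₃ (hb K (φ 0)) emb cover wm Theta d12 d34).GoodCtx (φ 0) (⟨K, t, φ 0, D⟩ : SeesawCtx K) ∧
        (thetaModelOf hHD hI h₁ h₃ (hb K (φ 0)) emb cover wm Theta d12 d34).SignsForced K K (RingHom.id K) (φ 0) t D ∧
        Module.finrank ℚ (⟨K, t, φ 0, D⟩ : SeesawCtx K).K = 6 :=
  exists_goodSexticO_self_at hHD hI h₁ h₃ hb emb cover wm Theta d12 d34 hK φ hφ t ht (RingHom.id K) (φ 0)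
    (RingHom.comp_id _)

/-- **All three guards of E's ∀(L,V,c)-binders are met OVER A SEXTIC ITSELF, at a canonical embedding.**  For EVERY bit
family `hb` and ALL data there are a sextic CM field `K` — PerL's hypothesis class: it has a normal closure `E` of degree
`24` or `48` (recorded) — a CANONICAL `ι₁ : K →+* ℂ` (`(mk ι₁).embedding = ι₁`), an anisotropic `V : HermSpace3 K ι₁`
and a GOOD context `⟨K, Ψ, σ, D⟩ : SeesawCtx K` of `thetaModelOf … (hb K ι₁) …` whose type field is `K`
(re-basing of `φ 0` along `id` or `complexConj K`: `exists_embedding_mk_comp_self`, `mk_embedding`). -/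
theorem exists_goodSexticO_self_canonical (hb : ∀ L : CMField, (L →+* ℂ) → Bool) (emb) (cover) (wm) (Theta)
    (d12 d34 : ∀ {L : CMField}, SeesawCtx L → SideData L) :
    ∃ (K : CMField) (ι₁ : K →+* ℂ) (V : HermSpace3 K ι₁) (Ψ : Fin 4 → CMType K) (σ : K →+* ℂ)
      (D : StubTree.SeesawDatum K),
      (∃ (E : CMField) (jE : K →+* E), IsNormalClosure ℚ K E ∧
          (Module.finrank ℚ E = 24 ∨ Module.finrank ℚ E = 48) ∧ ∃ ιE : E →+* ℂ, ιE.comp jE = σ) ∧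
      IsAnisotropic K V.Hm ∧
        (thetaModelOf hHD hI h₁ h₃ (hb K ι₁) emb cover wm Theta d12 d34).GoodCtx ι₁ (⟨K, Ψ, σ, D⟩ : SeesawCtx K) ∧
        Module.finrank ℚ K = 6 ∧ (NumberField.InfinitePlace.mk ι₁).embedding = ι₁ := by
  obtain ⟨K, E, jE, hN, hK, hE, φ, hφ, ιE, hιE, t, ht⟩ := HodgeCM.perLHypothesesInhabited
  obtain ⟨j, hj⟩ := exists_embedding_mk_comp_self K (φ 0)
  obtain ⟨V, D, hV, hc, -, -⟩ :=
    exists_goodSexticO_self_at hHD hI h₁ h₃ hb emb cover wm Theta d12 d34 hK φ hφ t ht j _ hj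
  exact ⟨K, _, V, t, φ 0, D, ⟨E, jE, hN, hE, ιE, hιE⟩, hV, hc, hK, by rw [NumberField.InfinitePlace.mk_embedding]⟩

end Sanity
end Model
end HodgeCM

end
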